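import Literature.Analysis.FluidPDE.LocalLerayCubicRearrangement
import Literature.Analysis.FluidPDE.WeakLaplacianInnerPairing
import HarnessLib

/-!
# The balance of `|u₁ - u₂|²` from the balances of `|u₁|²`, `|u₂|²` and `u₁·u₂`: the flux
identity on a time slice (Lemarié-Rieusset 2016, Thm. 14.7, pp. 515–516)

Analysis/FluidPDE theorem file (no new definitions, everything PROVED), on the inline proof path
of the named fact `Literature.Analysis.FluidPDE.local_leray_weak_strong_uniqueness`. The local
energy inequalities of the two solutions carry, on each time slice, the fluxes
`fᵢ = ∫ |uᵢ|² νΔφ + (|uᵢ|² + 2pᵢ) uᵢ·∇φ`, and the balance of `u₁·u₂` (each equation tested with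
`φ` times the other solution, Lemarié-Rieusset p. 515) carries the cross flux
`xf = Σ_{i≠j} ( -∫ ⟨(uᵢ·∇)uᵢ, φ uⱼ⟩ + ∫ pᵢ (uⱼ·∇φ) - ν ∫ Σₖ ⟨∂ₖuᵢ, ∂ₖφ uⱼ + φ ∂ₖuⱼ⟩ )`.
This file proves the slice identity behind "`∂ₜ(|w|²/2) = νΔ(|w|²/2) - ν|∇ ⊗ w|² - div(q w) -
A - μ`" (p. 515) and the display of p. 516:

* `LemarieRieusset2016.flux_combination_slice` —
  `½f₁ + ½f₂ - xf = (ν/2)∫ Δφ |w|² + ∫ (p₁ - p₂) w·∇φ + ( ∫ (w·∇φ)⟨u₁, w⟩ + ½∫ (u₁·∇φ)|w|²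
     - ½∫ (w·∇φ)|w|² + ∫ φ ⟨u₁, (∇w) w⟩ ) + 2ν ∫ φ ∇u₁ : ∇u₂`, `w = u₁ - u₂`,
  for slices as in `cubic_rearrangement_slice` (`LocalLerayCubicRearrangement.lean`) with
  pressures in `L^{3/2}` of the ball: the viscous terms by `integral_laplacian_mul_inner_eq_neg_sum`
  (`WeakLaplacianInnerPairing.lean`), the nonlinear terms by `cubic_rearrangement_slice`, the
  pressure terms by linear algebra.

## References

* P. G. Lemarié-Rieusset, *The Navier–Stokes Problem in the 21st Century* (2016), Thm. 14.7,
  proof, file pp. 515–516. [`LemarieRieusset2016`]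
-/

noncomputable section

open MeasureTheory TopologicalSpace Set Function Filter Topology InnerProductSpace Metric
open scoped RealInnerProductSpace ENNReal NNReal ContDiff Laplacian

namespace Literature.Analysis.FluidPDE

namespace LemarieRieusset2016

-- nested operator types
set_option maxSynthPendingDepth 3

/-! ## Integrability of the slice monomials -/

section Integrability

variable {x₀ : EuclideanSpace ℝ (Fin 3)} {ρ : ℝ} {φ : EuclideanSpace ℝ (Fin 3) → ℝ}

/-- `1/(3/2) + 1/3 = 1` (a private copy of the tree's `holderTriple_threeHalves_three_one'`).
[folklore] -/
private theorem holderTriple_threeHalves_three_one'' : ENNReal.HolderTriple (3 / 2 : ℝ≥0∞) 3 1 := by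
  refine ⟨?_⟩
  rw [ENNReal.inv_div (Or.inr (by norm_num)) (Or.inr (by norm_num)), inv_one]
  have e3 : (3 : ℝ≥0∞)⁻¹ = ((3⁻¹ : ℝ≥0) : ℝ≥0∞) := by rw [ENNReal.coe_inv (by norm_num)]; norm_num
  have e23 : (2 / 3 : ℝ≥0∞) = ((2 / 3 : ℝ≥0) : ℝ≥0∞) := by rw [ENNReal.coe_div (by norm_num)]; norm_num
  rw [e3, e23, ← ENNReal.coe_add, ← ENNReal.coe_one, ENNReal.coe_inj]
  norm_num

/-- `1/2 + 1/2 = 1`. [folklore] -/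
private theorem holderTriple_two_two_one' : ENNReal.HolderTriple 2 2 1 := by
  refine ⟨?_⟩
  rw [inv_one, ENNReal.inv_two_add_inv_two]

/-- **A bounded weight supported in the ball against an `L¹(B)` function is integrable on the
whole space.** [folklore] -/
theorem integrable_weight_mul_of_memLp_one {g : EuclideanSpace ℝ (Fin 3) → ℝ} (hg : Continuous g) {C : ℝ}
    (hgC : ∀ x, ‖g x‖ ≤ C) (hg0 : ∀ x, x ∉ ball x₀ ρ → g x = 0) {f : EuclideanSpace ℝ (Fin 3) → ℝ}
    (hf : MemLp f 1 (volume.restrict (ball x₀ ρ))) : Integrable (fun x => g x * f x) volume := by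
  have h1 : Integrable f (volume.restrict (ball x₀ ρ)) := memLp_one_iff_integrable.1 hf
  have hB : IntegrableOn (fun x => g x * f x) (ball x₀ ρ) volume :=
    h1.bdd_mul (c := C) hg.aestronglyMeasurable (Eventually.of_forall hgC)
  exact IntegrableOn.integrable_of_forall_notMem_eq_zero (f := fun x => g x * f x) hB fun x hx => by
    rw [hg0 x hx, zero_mul]

variable (hφ : FunctionSpaces.IsTestFunctionOn (⟨ball x₀ ρ, isOpen_ball⟩ : Opens (EuclideanSpace ℝ (Fin 3))) φ)
include hφ

omit hφ in
/-- A function vanishing off the ball and a.e.-strongly measurable on it is a.e.-strongly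
measurable. [folklore] -/
theorem aestronglyMeasurable_of_eq_zero_off_ball {F : Type*} [NormedAddCommGroup F]
    {f : EuclideanSpace ℝ (Fin 3) → F} (hf : AEStronglyMeasurable f (volume.restrict (ball x₀ ρ)))
    (hf0 : ∀ x, x ∉ ball x₀ ρ → f x = 0) : AEStronglyMeasurable f volume := by
  have h := (aestronglyMeasurable_indicator_iff (μ := (volume : Measure (EuclideanSpace ℝ (Fin 3))))
    measurableSet_ball).2 hf
  have e : (ball x₀ ρ).indicator f = f := funext fun x => by
    by_cases hx : x ∈ ball x₀ ρ
    · rw [indicator_of_mem hx]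
    · rw [indicator_of_notMem hx, hf0 x hx]
  rwa [e] at h

omit hφ in
/-- **Domination on the ball.** If `‖f‖ ≤ g` pointwise with `g` integrable on the ball, and `f`
vanishes off the ball and is measurable on it, then `f` is integrable. [folklore] -/
theorem integrable_of_norm_le_on_ball {f : EuclideanSpace ℝ (Fin 3) → ℝ} {g : EuclideanSpace ℝ (Fin 3) → ℝ}
    (hfm : AEStronglyMeasurable f (volume.restrict (ball x₀ ρ))) (hf0 : ∀ x, x ∉ ball x₀ ρ → f x = 0)
    (hg : Integrable g (volume.restrict (ball x₀ ρ))) (hfg : ∀ x, ‖f x‖ ≤ g x) : Integrable f volume := by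
  have hB : IntegrableOn f (ball x₀ ρ) volume := hg.mono' hfm (Eventually.of_forall hfg)
  exact IntegrableOn.integrable_of_forall_notMem_eq_zero (f := f) hB hf0

omit hφ in
/-- `1/6 + 1/6 = 1/3` (private copy). [folklore] -/
private theorem holderTriple_six_six_three'' : ENNReal.HolderTriple 6 6 3 := by
  refine ⟨?_⟩
  have e6 : (6 : ℝ≥0∞)⁻¹ = ((6⁻¹ : ℝ≥0) : ℝ≥0∞) := by rw [ENNReal.coe_inv (by norm_num)]; norm_num
  have e3 : (3 : ℝ≥0∞)⁻¹ = ((3⁻¹ : ℝ≥0) : ℝ≥0∞) := by rw [ENNReal.coe_inv (by norm_num)]; norm_num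
  rw [e6, e3, ← ENNReal.coe_add, ENNReal.coe_inj]
  norm_num

omit hφ in
/-- From `‖1_{B(x₀,ρ+2)} k‖_{L³} < ∞` to `k ∈ L³(B(x₀, ρ))`. [folklore] -/
theorem memLp_three_ball_of_indicator' {k : EuclideanSpace ℝ (Fin 3) → EuclideanSpace ℝ (Fin 3)}
    (hkm : AEStronglyMeasurable k volume) (hk3 : eLpNorm ((ball x₀ (ρ + 2)).indicator k) 3 volume < ⊤) :
    MemLp k 3 (volume.restrict (ball x₀ ρ)) := by
  have h : MemLp k 3 (volume.restrict (ball x₀ (ρ + 2))) :=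
    (memLp_indicator_iff_restrict measurableSet_ball).1 ⟨hkm.indicator measurableSet_ball, hk3⟩
  exact h.mono_measure (Measure.restrict_mono (ball_subset_ball (by linarith)) le_rfl)

/-- The gradient of a test function is continuous. [folklore] -/
theorem continuous_gradient_test : Continuous (gradient φ) := by
  have h : Continuous (fderiv ℝ φ) := hφ.contDiff.continuous_fderiv (by simp)
  unfold gradient
  exact (InnerProductSpace.toDual ℝ (EuclideanSpace ℝ (Fin 3))).symm.continuous.comp h

/-- The data of `φ`: bounds and vanishing of `φ`, `∇φ`, `Dφ`, `Δφ` off the ball. [folklore] -/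
theorem testFunction_ball_data :
    ∃ C : ℝ, (∀ x, ‖φ x‖ ≤ C) ∧ (∀ x, ‖fderiv ℝ φ x‖ ≤ C) ∧ (∀ x, ‖gradient φ x‖ ≤ C) ∧ (∀ x, ‖(Δ φ) x‖ ≤ C) ∧
      (∀ x, x ∉ ball x₀ ρ → φ x = 0) ∧ (∀ x, x ∉ ball x₀ ρ → fderiv ℝ φ x = 0) ∧
      (∀ x, x ∉ ball x₀ ρ → gradient φ x = 0) ∧ (∀ x, x ∉ ball x₀ ρ → (Δ φ) x = 0) := by
  have hφ2 : ContDiff ℝ 2 φ := hφ.contDiff.of_le (by norm_cast)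
  obtain ⟨C0, hC0⟩ := hφ.contDiff.continuous.bounded_above_of_compact_support hφ.hasCompactSupport
  have hDc : Continuous (fderiv ℝ φ) := hφ.contDiff.continuous_fderiv (by simp)
  obtain ⟨C1, hC1⟩ := hDc.bounded_above_of_compact_support (hφ.hasCompactSupport.fderiv ℝ)
  have hLc : Continuous (Δ φ) := continuous_laplacian hφ2
  have hL0 : ∀ x, x ∉ ball x₀ ρ → (Δ φ) x = 0 := fun x hx =>
    laplacian_eq_zero_of_notMem_tsupport fun h => hx (hφ.tsupport_subset h)
  obtain ⟨C2, hC2⟩ := hLc.bounded_above_of_compact_support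
    (HasCompactSupport.of_support_subset_isCompact (isCompact_closedBall x₀ ρ) fun x hx => by
      by_contra h
      exact hx (hL0 x fun h' => h (ball_subset_closedBall h')))
  refine ⟨max C0 (max C1 C2), fun x => (hC0 x).trans (le_max_left _ _),
    fun x => (hC1 x).trans ((le_max_left _ _).trans (le_max_right _ _)),
    fun x => ?_, fun x => (hC2 x).trans ((le_max_right _ _).trans (le_max_right _ _)),
    fun x hx => image_eq_zero_of_notMem_tsupport fun h => hx (hφ.tsupport_subset h),
    fun x hx => fderiv_of_notMem_tsupport ℝ fun h => hx (hφ.tsupport_subset h), fun x hx => ?_, hL0⟩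
  · have : ‖gradient φ x‖ = ‖fderiv ℝ φ x‖ := by
      rw [gradient, LinearIsometryEquiv.norm_map]
    rw [this]
    exact (hC1 x).trans ((le_max_left _ _).trans (le_max_right _ _))
  · rw [gradient, fderiv_of_notMem_tsupport ℝ fun h => hx (hφ.tsupport_subset h), map_zero]

/-- `|u|² Δφ` is integrable for `u ∈ L²(B)`. [folklore] -/
theorem integrable_normSq_mul_laplacian {u : EuclideanSpace ℝ (Fin 3) → EuclideanSpace ℝ (Fin 3)}
    (hu : MemLp u 2 (volume.restrict (ball x₀ ρ))) :
    Integrable (fun x => ‖u x‖ ^ 2 * (Δ φ) x) volume := by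
  have hφ2 : ContDiff ℝ 2 φ := hφ.contDiff.of_le (by norm_cast)
  obtain ⟨C, -, -, -, hLC, -, -, -, hL0⟩ := testFunction_ball_data hφ
  have hsq : MemLp (fun x => ‖u x‖ ^ 2) 1 (volume.restrict (ball x₀ ρ)) :=
    memLp_one_iff_integrable.2 ((memLp_two_iff_integrable_sq_norm hu.1).1 hu)
  have h := integrable_weight_mul_of_memLp_one (continuous_laplacian hφ2) hLC hL0 hsq
  exact h.congr (Eventually.of_forall fun x => by ring)

/-- `|u|² ⟨u, ∇φ⟩` is integrable for `u ∈ L³(B)`. [folklore] -/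
theorem integrable_normSq_mul_inner_gradient {u : EuclideanSpace ℝ (Fin 3) → EuclideanSpace ℝ (Fin 3)}
    (hum : AEStronglyMeasurable u volume) (hu : MemLp u 3 (volume.restrict (ball x₀ ρ))) :
    Integrable (fun x => ‖u x‖ ^ 2 * ⟪u x, gradient φ x⟫) volume := by
  obtain ⟨C, -, -, hgC, -, -, -, hg0, -⟩ := testFunction_ball_data hφ
  have hC : 0 ≤ C := (norm_nonneg _).trans (hgC x₀)
  have h3 : Integrable (fun x => C * ‖u x‖ ^ 3) (volume.restrict (ball x₀ ρ)) := by
    have := hu.integrable_norm_pow (by norm_num)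
    exact this.const_mul C
  refine integrable_of_norm_le_on_ball ?_ (fun x hx => by rw [hg0 x hx, inner_zero_right, mul_zero]) h3 fun x => ?_
  · exact ((hum.norm.pow 2).mul (hum.inner (continuous_gradient_test hφ).aestronglyMeasurable)).restrict
  · rw [norm_mul, norm_pow, norm_norm]
    calc ‖u x‖ ^ 2 * ‖⟪u x, gradient φ x⟫‖ ≤ ‖u x‖ ^ 2 * (‖u x‖ * C) :=
          mul_le_mul_of_nonneg_left ((norm_inner_le_norm _ _).trans
            (mul_le_mul_of_nonneg_left (hgC x) (norm_nonneg _))) (by positivity)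
      _ = C * ‖u x‖ ^ 3 := by ring

/-- `P ⟨u, ∇φ⟩` is integrable for `P ∈ L^{3/2}(B)`, `u ∈ L³(B)`. [folklore] -/
theorem integrable_pressure_mul_inner_gradient {P : EuclideanSpace ℝ (Fin 3) → ℝ}
    {u : EuclideanSpace ℝ (Fin 3) → EuclideanSpace ℝ (Fin 3)}
    (hP : MemLp P (3 / 2) (volume.restrict (ball x₀ ρ))) (hum : AEStronglyMeasurable u volume)
    (hu : MemLp u 3 (volume.restrict (ball x₀ ρ))) :
    Integrable (fun x => P x * ⟪u x, gradient φ x⟫) volume := by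
  haveI := holderTriple_threeHalves_three_one''
  obtain ⟨C, -, -, hgC, -, -, -, hg0, -⟩ := testFunction_ball_data hφ
  have hC : 0 ≤ C := (norm_nonneg _).trans (hgC x₀)
  have hPu : MemLp (fun x => ‖P x‖ * ‖u x‖) 1 (volume.restrict (ball x₀ ρ)) := hu.norm.mul' hP.norm
  have h1 : Integrable (fun x => C * (‖P x‖ * ‖u x‖)) (volume.restrict (ball x₀ ρ)) :=
    (memLp_one_iff_integrable.1 hPu).const_mul C
  refine integrable_of_norm_le_on_ball ?_ (fun x hx => by rw [hg0 x hx, inner_zero_right, mul_zero]) h1 fun x => ?_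
  · exact hP.1.mul (hum.inner (continuous_gradient_test hφ).aestronglyMeasurable).restrict
  · rw [norm_mul]
    calc ‖P x‖ * ‖⟪u x, gradient φ x⟫‖ ≤ ‖P x‖ * (‖u x‖ * C) :=
          mul_le_mul_of_nonneg_left ((norm_inner_le_norm _ _).trans
            (mul_le_mul_of_nonneg_left (hgC x) (norm_nonneg _))) (norm_nonneg _)
      _ = C * (‖P x‖ * ‖u x‖) := by ring

/-- `Δφ ⟨c, d⟩` is integrable for `c, d ∈ L²(B)`. [folklore] -/
theorem integrable_laplacian_mul_inner {c d : EuclideanSpace ℝ (Fin 3) → EuclideanSpace ℝ (Fin 3)}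
    (hc : MemLp c 2 (volume.restrict (ball x₀ ρ))) (hd : MemLp d 2 (volume.restrict (ball x₀ ρ))) :
    Integrable (fun x => (Δ φ) x * ⟪c x, d x⟫) volume := by
  haveI := holderTriple_two_two_one'
  obtain ⟨C, -, -, -, hLC, -, -, -, hL0⟩ := testFunction_ball_data hφ
  have hφ2 : ContDiff ℝ 2 φ := hφ.contDiff.of_le (by norm_cast)
  have hcd : MemLp (fun x => ‖c x‖ * ‖d x‖) 1 (volume.restrict (ball x₀ ρ)) := hd.norm.mul' hc.norm
  have h1 : Integrable (fun x => C * (‖c x‖ * ‖d x‖)) (volume.restrict (ball x₀ ρ)) :=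
    (memLp_one_iff_integrable.1 hcd).const_mul C
  refine integrable_of_norm_le_on_ball ?_ (fun x hx => by rw [hL0 x hx, zero_mul]) h1 fun x => ?_
  · exact ((continuous_laplacian hφ2).aestronglyMeasurable.restrict).mul (hc.1.inner hd.1)
  · rw [norm_mul]
    calc ‖(Δ φ) x‖ * ‖⟪c x, d x⟫‖ ≤ C * (‖c x‖ * ‖d x‖) := by
          gcongr
          · exact (norm_nonneg _).trans (hLC x)
          · exact hLC x
          · exact norm_inner_le_norm _ _
      _ = C * (‖c x‖ * ‖d x‖) := rfl

/-- `∑ᵢ ∂ᵢφ ⟨G eᵢ, u⟩` is integrable for `G ∈ L²(B)`, `u ∈ L²(B)`. [folklore] -/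
theorem integrable_sum_fderiv_mul_inner_apply
    {G : EuclideanSpace ℝ (Fin 3) → EuclideanSpace ℝ (Fin 3) →L[ℝ] EuclideanSpace ℝ (Fin 3)}
    {u : EuclideanSpace ℝ (Fin 3) → EuclideanSpace ℝ (Fin 3)}
    (hG : MemLp G 2 (volume.restrict (ball x₀ ρ))) (hu : MemLp u 2 (volume.restrict (ball x₀ ρ))) :
    Integrable (fun x => ∑ i, fderiv ℝ φ x (stdOrthonormalBasis ℝ (EuclideanSpace ℝ (Fin 3)) i) *
      ⟪G x (stdOrthonormalBasis ℝ (EuclideanSpace ℝ (Fin 3)) i), u x⟫) volume := by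
  haveI := holderTriple_two_two_one'
  set e := stdOrthonormalBasis ℝ (EuclideanSpace ℝ (Fin 3)) with he
  have he1 : ∀ i, ‖e i‖ = 1 := fun i => e.orthonormal.1 i
  obtain ⟨C, -, hDC, -, -, -, hD0, -, -⟩ := testFunction_ball_data hφ
  have hC : 0 ≤ C := (norm_nonneg _).trans (hDC x₀)
  refine integrable_finsetSum _ fun i _ => ?_
  have hGi : MemLp (fun x => G x (e i)) 2 (volume.restrict (ball x₀ ρ)) :=
    (ContinuousLinearMap.apply ℝ (EuclideanSpace ℝ (Fin 3)) (e i)).comp_memLp' hG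
  have hGu : MemLp (fun x => ‖G x (e i)‖ * ‖u x‖) 1 (volume.restrict (ball x₀ ρ)) := hu.norm.mul' hGi.norm
  have h1 : Integrable (fun x => C * (‖G x (e i)‖ * ‖u x‖)) (volume.restrict (ball x₀ ρ)) :=
    (memLp_one_iff_integrable.1 hGu).const_mul C
  have hDc : Continuous fun x => fderiv ℝ φ x (e i) :=
    (hφ.contDiff.continuous_fderiv (by simp)).clm_apply continuous_const
  refine integrable_of_norm_le_on_ball ?_ (fun x hx => by rw [hD0 x hx]; simp) h1 fun x => ?_
  · exact (hDc.aestronglyMeasurable.restrict).mul (hGi.1.inner hu.1)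
  · rw [norm_mul]
    exact mul_le_mul ((ContinuousLinearMap.le_opNorm _ _).trans (by rw [he1 i, mul_one]; exact hDC x))
      (norm_inner_le_norm _ _) (norm_nonneg _) hC

/-- `φ ∑ᵢ ⟨G₁ eᵢ, G₂ eᵢ⟩` is integrable for `G₁, G₂ ∈ L²(B)`. [folklore] -/
theorem integrable_test_mul_sum_inner_apply
    {G₁ G₂ : EuclideanSpace ℝ (Fin 3) → EuclideanSpace ℝ (Fin 3) →L[ℝ] EuclideanSpace ℝ (Fin 3)}
    (hG₁ : MemLp G₁ 2 (volume.restrict (ball x₀ ρ))) (hG₂ : MemLp G₂ 2 (volume.restrict (ball x₀ ρ))) :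
    Integrable (fun x => φ x * ∑ i, ⟪G₁ x (stdOrthonormalBasis ℝ (EuclideanSpace ℝ (Fin 3)) i),
      G₂ x (stdOrthonormalBasis ℝ (EuclideanSpace ℝ (Fin 3)) i)⟫) volume := by
  haveI := holderTriple_two_two_one'
  set e := stdOrthonormalBasis ℝ (EuclideanSpace ℝ (Fin 3)) with he
  obtain ⟨C, hφC, -, -, -, hφ0, -, -, -⟩ := testFunction_ball_data hφ
  have hC : 0 ≤ C := (norm_nonneg _).trans (hφC x₀)
  have e1 : (fun x => φ x * ∑ i, ⟪G₁ x (e i), G₂ x (e i)⟫) = fun x => ∑ i, φ x * ⟪G₁ x (e i), G₂ x (e i)⟫ := by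
    funext x; rw [Finset.mul_sum]
  rw [e1]
  refine integrable_finsetSum _ fun i _ => ?_
  have hG₁i : MemLp (fun x => G₁ x (e i)) 2 (volume.restrict (ball x₀ ρ)) :=
    (ContinuousLinearMap.apply ℝ (EuclideanSpace ℝ (Fin 3)) (e i)).comp_memLp' hG₁
  have hG₂i : MemLp (fun x => G₂ x (e i)) 2 (volume.restrict (ball x₀ ρ)) :=
    (ContinuousLinearMap.apply ℝ (EuclideanSpace ℝ (Fin 3)) (e i)).comp_memLp' hG₂
  have hGG : MemLp (fun x => ‖G₁ x (e i)‖ * ‖G₂ x (e i)‖) 1 (volume.restrict (ball x₀ ρ)) := hG₂i.norm.mul' hG₁i.norm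
  have h1 : Integrable (fun x => C * (‖G₁ x (e i)‖ * ‖G₂ x (e i)‖)) (volume.restrict (ball x₀ ρ)) :=
    (memLp_one_iff_integrable.1 hGG).const_mul C
  refine integrable_of_norm_le_on_ball ?_ (fun x hx => by rw [hφ0 x hx, zero_mul]) h1 fun x => ?_
  · exact (hφ.contDiff.continuous.aestronglyMeasurable.restrict).mul (hG₁i.1.inner hG₂i.1)
  · rw [norm_mul]
    exact mul_le_mul (hφC x) (norm_inner_le_norm _ _) (norm_nonneg _) hC

end Integrability

/-! ## The flux identity on a slice -/

set_option maxHeartbeats 800000 in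
/-- **The flux identity on a time slice** (Lemarié-Rieusset 2016, Thm. 14.7, proof, file
pp. 515–516). Let `a = u₁(t)`, `u₂ = u₂(t)` be slices as in `cubic_rearrangement_slice`
(measurable, weakly divergence free together with `w = a - u₂`, in `L³(B(x₀, ρ+2))`, with weak
gradients `G₁, G₂ ∈ L²(B(x₀,ρ))` and `a, u₂ ∈ L⁶(B(x₀,ρ))`), let `P₁, P₂ ∈ L^{3/2}(B(x₀,ρ))` be
the pressure slices and `φ ∈ C_c^∞(B(x₀, ρ))`. With the single-solution fluxes
`fᵢ = ∫ |uᵢ|²(νΔφ) + (|uᵢ|² + 2Pᵢ)⟨uᵢ, ∇φ⟩` and the cross flux of the balance of `u₁·u₂`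
(each equation tested with `φ` times the other slice),

  `½f₁ + ½f₂ - xf = (ν/2)∫ Δφ|w|² + ∫ (P₁ - P₂)⟨w, ∇φ⟩`
  `  + ( ∫ ⟨w,∇φ⟩⟨a, w⟩ + ½∫ ⟨a,∇φ⟩|w|² - ½∫ ⟨w,∇φ⟩|w|² + ∫ φ⟨a, (G₁ - G₂) w⟩ ) + 2ν ∫ φ ∑ᵢ ⟨G₁eᵢ, G₂eᵢ⟩`.

[cite: LemarieRieusset2016, Thm. 14.7, proof (file pp. 515–516)] -/
theorem flux_combination_slice {x₀ : EuclideanSpace ℝ (Fin 3)} {ρ : ℝ} {φ : EuclideanSpace ℝ (Fin 3) → ℝ}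
    {a u₂ : EuclideanSpace ℝ (Fin 3) → EuclideanSpace ℝ (Fin 3)} {P₁ P₂ : EuclideanSpace ℝ (Fin 3) → ℝ}
    {G₁ G₂ : EuclideanSpace ℝ (Fin 3) → EuclideanSpace ℝ (Fin 3) →L[ℝ] EuclideanSpace ℝ (Fin 3)} (ν : ℝ)
    (hdiv₁ : IsWeaklyDivFree a) (hdiv₂ : IsWeaklyDivFree u₂) (hdiv : IsWeaklyDivFree fun x => a x - u₂ x)
    (ham : AEStronglyMeasurable a volume) (hu₂m : AEStronglyMeasurable u₂ volume)
    (ha3 : eLpNorm ((ball x₀ (ρ + 2)).indicator a) 3 volume < ⊤)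
    (hu₂3 : eLpNorm ((ball x₀ (ρ + 2)).indicator u₂) 3 volume < ⊤)
    (ha : FunctionSpaces.HasWeakFDerivOn ⟨ball x₀ ρ, isOpen_ball⟩ volume a G₁)
    (hu₂ : FunctionSpaces.HasWeakFDerivOn ⟨ball x₀ ρ, isOpen_ball⟩ volume u₂ G₂)
    (ha6 : MemLp a 6 (volume.restrict (ball x₀ ρ))) (hu₂6 : MemLp u₂ 6 (volume.restrict (ball x₀ ρ)))
    (hG₁ : MemLp G₁ 2 (volume.restrict (ball x₀ ρ))) (hG₂ : MemLp G₂ 2 (volume.restrict (ball x₀ ρ)))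
    (hP₁ : MemLp P₁ (3 / 2) (volume.restrict (ball x₀ ρ))) (hP₂ : MemLp P₂ (3 / 2) (volume.restrict (ball x₀ ρ)))
    (hφ : FunctionSpaces.IsTestFunctionOn (⟨ball x₀ ρ, isOpen_ball⟩ : Opens (EuclideanSpace ℝ (Fin 3))) φ) :
    2⁻¹ * (∫ x, (‖a x‖ ^ 2 * (ν * (Δ φ) x) + (‖a x‖ ^ 2 + 2 * P₁ x) * ⟪a x, gradient φ x⟫)) +
      2⁻¹ * (∫ x, (‖u₂ x‖ ^ 2 * (ν * (Δ φ) x) + (‖u₂ x‖ ^ 2 + 2 * P₂ x) * ⟪u₂ x, gradient φ x⟫)) -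
      ((((-∫ x, ⟪G₂ x (u₂ x), φ x • a x⟫) + ∫ x, P₂ x * fderiv ℝ φ x (a x)) -
          ν * ∫ x, ∑ i, ⟪G₂ x (stdOrthonormalBasis ℝ (EuclideanSpace ℝ (Fin 3)) i),
            fderiv ℝ φ x (stdOrthonormalBasis ℝ (EuclideanSpace ℝ (Fin 3)) i) • a x +
              φ x • G₁ x (stdOrthonormalBasis ℝ (EuclideanSpace ℝ (Fin 3)) i)⟫) +
        (((-∫ x, ⟪G₁ x (a x), φ x • u₂ x⟫) + ∫ x, P₁ x * fderiv ℝ φ x (u₂ x)) -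
          ν * ∫ x, ∑ i, ⟪G₁ x (stdOrthonormalBasis ℝ (EuclideanSpace ℝ (Fin 3)) i),
            fderiv ℝ φ x (stdOrthonormalBasis ℝ (EuclideanSpace ℝ (Fin 3)) i) • u₂ x +
              φ x • G₂ x (stdOrthonormalBasis ℝ (EuclideanSpace ℝ (Fin 3)) i)⟫)) =
    ν / 2 * (∫ x, (Δ φ) x * ‖a x - u₂ x‖ ^ 2) +
      (∫ x, (P₁ x - P₂ x) * ⟪a x - u₂ x, gradient φ x⟫) +
      ((∫ x, ⟪a x - u₂ x, gradient φ x⟫ * ⟪a x, a x - u₂ x⟫) +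
        2⁻¹ * (∫ x, ⟪a x, gradient φ x⟫ * ‖a x - u₂ x‖ ^ 2) -
        2⁻¹ * (∫ x, ⟪a x - u₂ x, gradient φ x⟫ * ‖a x - u₂ x‖ ^ 2) +
        ∫ x, φ x * ⟪a x, (G₁ x - G₂ x) (a x - u₂ x)⟫) +
      2 * ν * ∫ x, φ x * ∑ i, ⟪G₁ x (stdOrthonormalBasis ℝ (EuclideanSpace ℝ (Fin 3)) i),
        G₂ x (stdOrthonormalBasis ℝ (EuclideanSpace ℝ (Fin 3)) i)⟫ := by
  haveI hfin : IsFiniteMeasure ((volume : Measure (EuclideanSpace ℝ (Fin 3))).restrict (ball x₀ ρ)) :=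
    isFiniteMeasure_restrict.2 measure_ball_lt_top.ne
  -- ## data
  have h26 : (2 : ℝ≥0∞) ≤ 6 := by norm_num
  have ha2 : MemLp a 2 (volume.restrict (ball x₀ ρ)) := ha6.mono_exponent h26
  have hu₂2 : MemLp u₂ 2 (volume.restrict (ball x₀ ρ)) := hu₂6.mono_exponent h26
  have ha3' := memLp_three_ball_of_indicator' ham ha3
  have hu₂3' := memLp_three_ball_of_indicator' hu₂m hu₂3
  have hDφ : ∀ x v, fderiv ℝ φ x v = ⟪v, gradient φ x⟫ := fun x v => (inner_gradient_eq_fderiv_apply x v).symm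
  -- ## integrability of the monomials
  have L_a := integrable_normSq_mul_laplacian hφ ha2
  have L_u := integrable_normSq_mul_laplacian hφ hu₂2
  have L_au := integrable_laplacian_mul_inner hφ ha2 hu₂2
  have L_aa := integrable_laplacian_mul_inner hφ ha2 ha2
  have L_uu := integrable_laplacian_mul_inner hφ hu₂2 hu₂2
  have C_a := integrable_normSq_mul_inner_gradient hφ ham ha3'
  have C_u := integrable_normSq_mul_inner_gradient hφ hu₂m hu₂3'
  have Q₁₁ := integrable_pressure_mul_inner_gradient hφ hP₁ ham ha3'
  have Q₁₂ := integrable_pressure_mul_inner_gradient hφ hP₁ hu₂m hu₂3'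
  have Q₂₁ := integrable_pressure_mul_inner_gradient hφ hP₂ ham ha3'
  have Q₂₂ := integrable_pressure_mul_inner_gradient hφ hP₂ hu₂m hu₂3'
  have N₁₂ := integrable_test_mul_inner_apply hφ ha6 hG₂ hu₂3'   -- `φ ⟨a, G₂ u₂⟩`
  have N₂₁ := integrable_test_mul_inner_apply hφ hu₂6 hG₁ ha3'   -- `φ ⟨u₂, G₁ a⟩`
  have S₂₁ := integrable_sum_fderiv_mul_inner_apply hφ hG₂ ha2    -- `Σ ∂ᵢφ ⟨G₂ eᵢ, a⟩`
  have S₁₂ := integrable_sum_fderiv_mul_inner_apply hφ hG₁ hu₂2   -- `Σ ∂ᵢφ ⟨G₁ eᵢ, u₂⟩`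
  have D₁₂ := integrable_test_mul_sum_inner_apply hφ hG₁ hG₂      -- `φ Σ ⟨G₁ eᵢ, G₂ eᵢ⟩`
  have D₂₁ := integrable_test_mul_sum_inner_apply hφ hG₂ hG₁
  -- ## the fluxes `fᵢ`, split
  have hf₁ : (∫ x, (‖a x‖ ^ 2 * (ν * (Δ φ) x) + (‖a x‖ ^ 2 + 2 * P₁ x) * ⟪a x, gradient φ x⟫)) =
      ν * (∫ x, ‖a x‖ ^ 2 * (Δ φ) x) + (∫ x, ‖a x‖ ^ 2 * ⟪a x, gradient φ x⟫) + 2 * ∫ x, P₁ x * ⟪a x, gradient φ x⟫ := by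
    have e1 : (fun x => ‖a x‖ ^ 2 * (ν * (Δ φ) x) + (‖a x‖ ^ 2 + 2 * P₁ x) * ⟪a x, gradient φ x⟫) =
        fun x => ν * (‖a x‖ ^ 2 * (Δ φ) x) + ‖a x‖ ^ 2 * ⟪a x, gradient φ x⟫ + 2 * (P₁ x * ⟪a x, gradient φ x⟫) := by
      funext x; ring
    have i1 : Integrable (fun x => ν * (‖a x‖ ^ 2 * (Δ φ) x)) volume := L_a.const_mul ν
    have i2 : Integrable (fun x => ν * (‖a x‖ ^ 2 * (Δ φ) x) + ‖a x‖ ^ 2 * ⟪a x, gradient φ x⟫) volume := i1.add C_a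
    have i3 : Integrable (fun x => 2 * (P₁ x * ⟪a x, gradient φ x⟫)) volume := Q₁₁.const_mul 2
    rw [e1, integral_add i2 i3, integral_add i1 C_a, integral_const_mul, integral_const_mul]
  have hf₂ : (∫ x, (‖u₂ x‖ ^ 2 * (ν * (Δ φ) x) + (‖u₂ x‖ ^ 2 + 2 * P₂ x) * ⟪u₂ x, gradient φ x⟫)) =
      ν * (∫ x, ‖u₂ x‖ ^ 2 * (Δ φ) x) + (∫ x, ‖u₂ x‖ ^ 2 * ⟪u₂ x, gradient φ x⟫) + 2 * ∫ x, P₂ x * ⟪u₂ x, gradient φ x⟫ := by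
    have e1 : (fun x => ‖u₂ x‖ ^ 2 * (ν * (Δ φ) x) + (‖u₂ x‖ ^ 2 + 2 * P₂ x) * ⟪u₂ x, gradient φ x⟫) =
        fun x => ν * (‖u₂ x‖ ^ 2 * (Δ φ) x) + ‖u₂ x‖ ^ 2 * ⟪u₂ x, gradient φ x⟫ + 2 * (P₂ x * ⟪u₂ x, gradient φ x⟫) := by
      funext x; ring
    have i1 : Integrable (fun x => ν * (‖u₂ x‖ ^ 2 * (Δ φ) x)) volume := L_u.const_mul ν
    have i2 : Integrable (fun x => ν * (‖u₂ x‖ ^ 2 * (Δ φ) x) + ‖u₂ x‖ ^ 2 * ⟪u₂ x, gradient φ x⟫) volume := i1.add C_u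
    have i3 : Integrable (fun x => 2 * (P₂ x * ⟪u₂ x, gradient φ x⟫)) volume := Q₂₂.const_mul 2
    rw [e1, integral_add i2 i3, integral_add i1 C_u, integral_const_mul, integral_const_mul]
  -- ## the cross flux, rewritten
  have hX₁ : (∫ x, ⟪G₂ x (u₂ x), φ x • a x⟫) = ∫ x, φ x * ⟪a x, G₂ x (u₂ x)⟫ :=
    integral_congr_ae (Eventually.of_forall fun x => by
      simp only [inner_smul_right, real_inner_comm (a x)])
  have hX₂ : (∫ x, ⟪G₁ x (a x), φ x • u₂ x⟫) = ∫ x, φ x * ⟪u₂ x, G₁ x (a x)⟫ :=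
    integral_congr_ae (Eventually.of_forall fun x => by
      simp only [inner_smul_right, real_inner_comm (u₂ x)])
  have hX₃ : (∫ x, P₂ x * fderiv ℝ φ x (a x)) = ∫ x, P₂ x * ⟪a x, gradient φ x⟫ :=
    integral_congr_ae (Eventually.of_forall fun x => by simp only [hDφ])
  have hX₄ : (∫ x, P₁ x * fderiv ℝ φ x (u₂ x)) = ∫ x, P₁ x * ⟪u₂ x, gradient φ x⟫ :=
    integral_congr_ae (Eventually.of_forall fun x => by simp only [hDφ])
  have hX₅ : (∫ x, ∑ i, ⟪G₂ x (stdOrthonormalBasis ℝ (EuclideanSpace ℝ (Fin 3)) i), fderiv ℝ φ x (stdOrthonormalBasis ℝ (EuclideanSpace ℝ (Fin 3)) i) • a x + φ x • G₁ x (stdOrthonormalBasis ℝ (EuclideanSpace ℝ (Fin 3)) i)⟫) =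
      (∫ x, ∑ i, fderiv ℝ φ x (stdOrthonormalBasis ℝ (EuclideanSpace ℝ (Fin 3)) i) * ⟪G₂ x (stdOrthonormalBasis ℝ (EuclideanSpace ℝ (Fin 3)) i), a x⟫) + ∫ x, φ x * ∑ i, ⟪G₂ x (stdOrthonormalBasis ℝ (EuclideanSpace ℝ (Fin 3)) i), G₁ x (stdOrthonormalBasis ℝ (EuclideanSpace ℝ (Fin 3)) i)⟫ := by
    rw [← integral_add S₂₁ D₂₁]
    refine integral_congr_ae (Eventually.of_forall fun x => ?_)
    simp only [inner_add_right, inner_smul_right, Finset.sum_add_distrib, Finset.mul_sum]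
  have hX₆ : (∫ x, ∑ i, ⟪G₁ x (stdOrthonormalBasis ℝ (EuclideanSpace ℝ (Fin 3)) i), fderiv ℝ φ x (stdOrthonormalBasis ℝ (EuclideanSpace ℝ (Fin 3)) i) • u₂ x + φ x • G₂ x (stdOrthonormalBasis ℝ (EuclideanSpace ℝ (Fin 3)) i)⟫) =
      (∫ x, ∑ i, fderiv ℝ φ x (stdOrthonormalBasis ℝ (EuclideanSpace ℝ (Fin 3)) i) * ⟪G₁ x (stdOrthonormalBasis ℝ (EuclideanSpace ℝ (Fin 3)) i), u₂ x⟫) + ∫ x, φ x * ∑ i, ⟪G₁ x (stdOrthonormalBasis ℝ (EuclideanSpace ℝ (Fin 3)) i), G₂ x (stdOrthonormalBasis ℝ (EuclideanSpace ℝ (Fin 3)) i)⟫ := by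
    rw [← integral_add S₁₂ D₁₂]
    refine integral_congr_ae (Eventually.of_forall fun x => ?_)
    simp only [inner_add_right, inner_smul_right, Finset.sum_add_distrib, Finset.mul_sum]
  have hD : (∫ x, φ x * ∑ i, ⟪G₂ x (stdOrthonormalBasis ℝ (EuclideanSpace ℝ (Fin 3)) i), G₁ x (stdOrthonormalBasis ℝ (EuclideanSpace ℝ (Fin 3)) i)⟫) = ∫ x, φ x * ∑ i, ⟪G₁ x (stdOrthonormalBasis ℝ (EuclideanSpace ℝ (Fin 3)) i), G₂ x (stdOrthonormalBasis ℝ (EuclideanSpace ℝ (Fin 3)) i)⟫ :=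
    integral_congr_ae (Eventually.of_forall fun x => by simp only [real_inner_comm (G₁ x _)])
  -- ## the viscous identity
  have hV := integral_laplacian_mul_inner_eq_neg_sum ha hu₂ ha2 hu₂2 hG₁ hG₂ hφ
  have hV' : (∫ x, ∑ i, fderiv ℝ φ x (stdOrthonormalBasis ℝ (EuclideanSpace ℝ (Fin 3)) i) * (⟪G₁ x (stdOrthonormalBasis ℝ (EuclideanSpace ℝ (Fin 3)) i), u₂ x⟫ + ⟪a x, G₂ x (stdOrthonormalBasis ℝ (EuclideanSpace ℝ (Fin 3)) i)⟫)) =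
      (∫ x, ∑ i, fderiv ℝ φ x (stdOrthonormalBasis ℝ (EuclideanSpace ℝ (Fin 3)) i) * ⟪G₁ x (stdOrthonormalBasis ℝ (EuclideanSpace ℝ (Fin 3)) i), u₂ x⟫) + ∫ x, ∑ i, fderiv ℝ φ x (stdOrthonormalBasis ℝ (EuclideanSpace ℝ (Fin 3)) i) * ⟪G₂ x (stdOrthonormalBasis ℝ (EuclideanSpace ℝ (Fin 3)) i), a x⟫ := by
    rw [← integral_add S₁₂ S₂₁]
    refine integral_congr_ae (Eventually.of_forall fun x => ?_)
    simp only [mul_add, Finset.sum_add_distrib, real_inner_comm (a x)]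
  rw [hV'] at hV
  -- `∫ Δφ |w|² = ∫ Δφ |a|² + ∫ Δφ |u₂|² - 2 ∫ Δφ ⟨a, u₂⟩`
  have hW : (∫ x, (Δ φ) x * ‖a x - u₂ x‖ ^ 2) =
      (∫ x, ‖a x‖ ^ 2 * (Δ φ) x) + (∫ x, ‖u₂ x‖ ^ 2 * (Δ φ) x) - 2 * ∫ x, (Δ φ) x * ⟪a x, u₂ x⟫ := by
    have i1 : Integrable (fun x => ‖a x‖ ^ 2 * (Δ φ) x + ‖u₂ x‖ ^ 2 * (Δ φ) x) volume := L_a.add L_u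
    have i2 : Integrable (fun x => 2 * ((Δ φ) x * ⟪a x, u₂ x⟫)) volume := L_au.const_mul 2
    rw [← integral_const_mul, ← integral_add L_a L_u, ← integral_sub i1 i2]
    refine integral_congr_ae (Eventually.of_forall fun x => ?_)
    simp only [@norm_sub_sq_real]
    ring
  -- ## the pressure identity
  have hPr : (∫ x, (P₁ x - P₂ x) * ⟪a x - u₂ x, gradient φ x⟫) =
      (∫ x, P₁ x * ⟪a x, gradient φ x⟫) - (∫ x, P₁ x * ⟪u₂ x, gradient φ x⟫) -
        (∫ x, P₂ x * ⟪a x, gradient φ x⟫) + ∫ x, P₂ x * ⟪u₂ x, gradient φ x⟫ := by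
    have i1 : Integrable (fun x => P₁ x * ⟪a x, gradient φ x⟫ - P₁ x * ⟪u₂ x, gradient φ x⟫) volume := Q₁₁.sub Q₁₂
    have i2 : Integrable (fun x => P₁ x * ⟪a x, gradient φ x⟫ - P₁ x * ⟪u₂ x, gradient φ x⟫ -
        P₂ x * ⟪a x, gradient φ x⟫) volume := i1.sub Q₂₁
    rw [← integral_sub Q₁₁ Q₁₂, ← integral_sub i1 Q₂₁, ← integral_add i2 Q₂₂]
    refine integral_congr_ae (Eventually.of_forall fun x => ?_)
    simp only [inner_sub_left]
    ring
  -- ## the cubic rearrangement (in `fderiv` form), converted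
  have hCu := cubic_rearrangement_slice hdiv₁ hdiv₂ hdiv ham hu₂m ha3 hu₂3 ha hu₂ ha6 hu₂6 hG₁ hG₂ hφ
  simp only [hDφ] at hCu
  have c1 : (∫ x, ⟪a x, gradient φ x⟫ * ‖a x‖ ^ 2) = ∫ x, ‖a x‖ ^ 2 * ⟪a x, gradient φ x⟫ :=
    integral_congr_ae (Eventually.of_forall fun x => by ring)
  have c2 : (∫ x, ⟪u₂ x, gradient φ x⟫ * ‖u₂ x‖ ^ 2) = ∫ x, ‖u₂ x‖ ^ 2 * ⟪u₂ x, gradient φ x⟫ :=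
    integral_congr_ae (Eventually.of_forall fun x => by ring)
  rw [c1, c2] at hCu
  -- ## conclusion
  rw [hf₁, hf₂, hX₁, hX₂, hX₃, hX₄, hX₅, hX₆, hD, hW, hPr]
  linear_combination ν * hV + hCu

end LemarieRieusset2016

end Literature.Analysis.FluidPDE
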